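import Summits.ABC.ABC.Theorems.SoloBlindCycloRad
import HarnessLib.Audit
import HarnessLib

/-!
# abc as an all-places estimate for one linear form in two logarithms (solo-ABC-blind, generation 2)

A kernel statement about the *shape* of what a proof of abc must deliver, II (companion of
`SoloBlindBaker`): abc is *exactly* a simultaneous archimedean + `p`-adic lower bound for the single
linear form `Λ = log(a/b)`, in Baker's `Ξ` notation.

**abc ⟺ a simultaneous (all places) lower bound for `Λ = log(a/b)`.** Following Baker
([Baker2004, §2, p. 256]; [BakerWustholz2007, §3.7, p. 69]): for coprime positive integers `a > b`
put `c = a − b`, `Λ = log(a/b)`, `|Λ|_p := |c|_p` for `p ∣ c` and `|Λ|_p := 1` otherwise, and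
`Ξ = min(1, |Λ|) ∏_p min(1, p |Λ|_p)`.  Since `min(1, p · p^{-v_p(c)}) = p^{1 - v_p(c)}` for `p ∣ c`,
`Ξ = min(1, log(a/b)) · rad(c)/c`; this closed form is `bakerXi a b`.  `abc_iff_xiLowerBound`:
abc holds iff for every `ε > 0` there is `K > 0` with
`Ξ ≥ K · (rad a · rad b)^{-(1+ε)} · a^{-ε}` for all coprime `a > b ≥ 1`
— i.e. abc is *exactly* the statement that one non-zero linear form in two logarithms of coprime
integers cannot be small at all places simultaneously beyond `(rad a rad b)^{-1-ε} H^{-ε}`.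
(Baker [Baker1998] proved the analogous equivalence for his refined conjecture, cf. Philippon,
Bull. Austral. Math. Soc. 59 (1999) p. 331 [Philippon1999, §3(b)]; the plain-abc version recorded
here is the folklore form of that dictionary.)
-/

noncomputable section

open UniqueFactorizationMonoid Finset

namespace Summit.ABC.ABC.Theorems

open Literature.NumberTheory.DiophantineGeometry

/-! ### abc as an all-places estimate for `Λ = log(a/b)` -/

/-- **Baker's `Ξ`** for the linear form `Λ = log(a/b)` in two logarithms of coprime positive integers
`a > b` (Baker 2004 §2, p. 256; Baker–Wüstholz 2007 §3.7, p. 69): with `c = a − b`,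
`|Λ|_p := |c|_p` for `p ∣ c` (and `1` otherwise), `Ξ = min(1, |Λ|) · ∏_p min(1, p |Λ|_p)`.
For `p ∣ c`, `min(1, p · p^{-v_p(c)}) = p^{1 - v_p(c)}`, so `∏_p min(1, p|Λ|_p) = rad(c)/c` and
`Ξ = min(1, log(a/b)) · rad(a − b)/(a − b)`, which is the closed form used here (`ℕ`-subtraction:
intended for `b < a`; for `a ≤ b` the value is the junk `min(1, log(a/b)) · 1 / 0 = 0`).
[cite: Baker2004, §2 (p. 256)] [cite: BakerWustholz2007, §3.7 (p. 69)] -/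
def bakerXi (a b : ℕ) : ℝ :=
  min 1 (Real.log ((a : ℝ) / (b : ℝ))) * ((((radical (a - b) : ℕ) : ℝ)) / (((a - b : ℕ) : ℝ)))

/-- **All-places lower bound for one linear form in two logarithms, abc strength.**  For every
`ε > 0` there is `K > 0` such that for all coprime integers `a > b ≥ 1`,
`Ξ(log(a/b)) ≥ K · (rad a · rad b)^{-(1+ε)} · a^{-ε}`.  Equivalent to abc (`abc_iff_xiLowerBound`);
the form of the bound (product of the supports of the two arguments to the power `-(1+ε)`, times
`H^{-ε}`, `H = max(a, b)` the height of `a/b`) is the plain-abc analogue of Baker's equivalence for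
his refined conjecture [Baker1998] as reported by Philippon [Philippon1999, §3(b), p. 331].
Dictionary with Baker's coordinates (Baker 2004, p. 256): writing `a/b = ∏ pᵢ^{uᵢ}` over the primes
`pᵢ ∣ ab`, `Λ = Σ uᵢ log pᵢ`, one has `rad a · rad b = ∏ pᵢ = exp(Σ h'(pᵢ))` and `a ≤ H(a/b)`, so the
bound reads `log Ξ ≥ log K − (1+ε) Σᵢ log pᵢ − ε log H`: the archimedean valuation replaced by `Ξ`
("(i)") and the product of the heights replaced by their sum ("(ii)"), with the dependence on the
coefficients `uᵢ` confined to the factor `H^{-ε}`.  Baker's "slightly weaker form"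
`log Ξ ≫ −(Σ log pᵢ) log max|uᵢ|` is NOT of this strength (it loses a factor `(rad ab)^{O(log log a)}`).
An open statement (equivalent to the summit, `abc_iff_xiLowerBound`), recorded as a `@[conjecture]`
obligation node. [cite: Baker2004, §2 (p. 256)] [status: open] -/
@[conjecture] def XiLowerBound : Prop :=
  ∀ ε : ℝ, 0 < ε → ∃ K : ℝ, 0 < K ∧ ∀ a b : ℕ, 0 < b → b < a → Nat.Coprime a b →
    K * (((radical a : ℕ) : ℝ) * ((radical b : ℕ) : ℝ)) ^ (-(1 + ε)) * (a : ℝ) ^ (-ε) ≤ bakerXi a b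

/-- Lower estimate `Ξ(a, b) ≥ rad(a − b)/a` for `0 < b < a`
(from `log x ≥ 1 − 1/x`). [folklore] -/
theorem radical_div_le_bakerXi {a b : ℕ} (hb : 0 < b) (hba : b < a) :
    ((radical (a - b) : ℕ) : ℝ) / (a : ℝ) ≤ bakerXi a b := by
  have ha0 : (0 : ℝ) < a := by exact_mod_cast (show 0 < a by omega)
  have hb0 : (0 : ℝ) < b := by exact_mod_cast hb
  have hc0 : (0 : ℝ) < ((a - b : ℕ) : ℝ) := by exact_mod_cast (show 0 < a - b by omega)
  have hcast : ((a - b : ℕ) : ℝ) = (a : ℝ) - (b : ℝ) := by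
    rw [Nat.cast_sub hba.le]
  have hrad0 : (0 : ℝ) ≤ ((radical (a - b) : ℕ) : ℝ) := Nat.cast_nonneg _
  -- min(1, log(a/b)) ≥ (a - b)/a
  have hmin : ((a : ℝ) - b) / a ≤ min 1 (Real.log ((a : ℝ) / (b : ℝ))) := by
    apply le_min
    · rw [div_le_one ha0]; linarith
    · have h := Real.one_sub_inv_le_log_of_pos (show (0 : ℝ) < (a : ℝ) / b by positivity)
      rw [inv_div] at h
      have : ((a : ℝ) - b) / a = 1 - (b : ℝ) / a := by field_simp
      rw [this]; exact h
  unfold bakerXi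
  rw [hcast]
  have hc0' : (0 : ℝ) < (a : ℝ) - b := by rw [← hcast]; exact hc0
  calc ((radical (a - b) : ℕ) : ℝ) / (a : ℝ)
        = (((a : ℝ) - b) / a) * (((radical (a - b) : ℕ) : ℝ) / ((a : ℝ) - b)) := by
          field_simp
    _ ≤ min 1 (Real.log ((a : ℝ) / (b : ℝ))) * (((radical (a - b) : ℕ) : ℝ) / ((a : ℝ) - b)) :=
          mul_le_mul_of_nonneg_right hmin (by positivity)

/-- Upper estimate `Ξ(a, b) ≤ rad(a − b)/b` for `0 < b < a` (from `log x ≤ x − 1`). [folklore] -/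
theorem bakerXi_le_radical_div {a b : ℕ} (hb : 0 < b) (hba : b < a) :
    bakerXi a b ≤ ((radical (a - b) : ℕ) : ℝ) / (b : ℝ) := by
  have ha0 : (0 : ℝ) < a := by exact_mod_cast (show 0 < a by omega)
  have hb0 : (0 : ℝ) < b := by exact_mod_cast hb
  have hcast : ((a - b : ℕ) : ℝ) = (a : ℝ) - (b : ℝ) := by rw [Nat.cast_sub hba.le]
  have hc0' : (0 : ℝ) < (a : ℝ) - b := by
    have : (b : ℝ) < a := by exact_mod_cast hba
    linarith
  have hrad0 : (0 : ℝ) ≤ ((radical (a - b) : ℕ) : ℝ) := Nat.cast_nonneg _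
  have hmin : min 1 (Real.log ((a : ℝ) / (b : ℝ))) ≤ ((a : ℝ) - b) / b := by
    have h := Real.log_le_sub_one_of_pos (show (0 : ℝ) < (a : ℝ) / b by positivity)
    have : (a : ℝ) / b - 1 = ((a : ℝ) - b) / b := by field_simp
    rw [this] at h
    exact (min_le_right _ _).trans h
  unfold bakerXi
  rw [hcast]
  calc min 1 (Real.log ((a : ℝ) / (b : ℝ))) * (((radical (a - b) : ℕ) : ℝ) / ((a : ℝ) - b))
        ≤ (((a : ℝ) - b) / b) * (((radical (a - b) : ℕ) : ℝ) / ((a : ℝ) - b)) :=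
          mul_le_mul_of_nonneg_right hmin (by positivity)
    _ = ((radical (a - b) : ℕ) : ℝ) / (b : ℝ) := by field_simp

/-- `rad(x y z) = rad x · rad y · rad z` (as reals) for an abc triple (pairwise coprime). [folklore] -/
theorem rad_eq_mul_of_isABCTriple {x y z : ℕ} (h : IsABCTriple x y z) :
    ((rad x y z : ℕ) : ℝ) = ((radical x : ℕ) : ℝ) * ((radical y : ℕ) : ℝ) * ((radical z : ℕ) : ℝ) := by
  obtain ⟨hx, hy, hxyz, hcop⟩ := h
  have hxz : Nat.Coprime x z := by
    rw [← hxyz, Nat.Coprime, Nat.gcd_self_add_right]; exact hcop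
  have hyz : Nat.Coprime y z := by
    rw [← hxyz, Nat.Coprime, add_comm, Nat.gcd_self_add_right]; exact hcop.symm
  have h1 : radical (x * y) = radical x * radical y :=
    radical_mul (Nat.coprime_iff_isRelPrime.mp hcop)
  have hxy_z : Nat.Coprime (x * y) z := Nat.Coprime.mul_left hxz hyz
  have h2 : radical (x * y * z) = radical (x * y) * radical z :=
    radical_mul (Nat.coprime_iff_isRelPrime.mp hxy_z)
  rw [rad_def, h2, h1]; push_cast; ring

/-- `rad(x y z) ≤ rad x · rad y · rad z` (as reals), no coprimality needed. [folklore] -/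
theorem rad_le_mul (x y z : ℕ) :
    ((rad x y z : ℕ) : ℝ) ≤ ((radical x : ℕ) : ℝ) * ((radical y : ℕ) : ℝ) * ((radical z : ℕ) : ℝ) := by
  have h1 : radical (x * y * z) ∣ radical (x * y) * radical z := radical_mul_dvd
  have h2 : radical (x * y) * radical z ∣ radical x * radical y * radical z :=
    mul_dvd_mul_right radical_mul_dvd _
  have hpos : 0 < radical x * radical y * radical z := by
    have := Nat.radical_pos x; have := Nat.radical_pos y; have := Nat.radical_pos z; positivity
  have h := Nat.le_of_dvd hpos (h1.trans h2)
  rw [rad_def]; exact_mod_cast h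

/-- **abc implies the all-places bound for `Λ = log(a/b)`.** [folklore] -/
theorem xiLowerBound_of_abc (habc : ABC) : XiLowerBound := by
  rw [ABC_iff] at habc
  intro ε hε
  obtain ⟨C, hC, H⟩ := habc ε hε
  refine ⟨1 / C, by positivity, ?_⟩
  intro a b hb hba hcop
  -- the triple b + (a - b) = a
  have hc : 0 < a - b := by omega
  have htri : IsABCTriple b (a - b) a := by
    refine ⟨hb, hc, by omega, ?_⟩
    exact (Nat.coprime_sub_self_right hba.le).mpr hcop.symm
  have hA := H b (a - b) a htri
  have hradeq := rad_eq_mul_of_isABCTriple htri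
  have ha0 : (0 : ℝ) < a := by exact_mod_cast (show 0 < a by omega)
  set Ra : ℝ := ((radical a : ℕ) : ℝ) with hRa
  set Rb : ℝ := ((radical b : ℕ) : ℝ) with hRb
  set Rc : ℝ := ((radical (a - b) : ℕ) : ℝ) with hRc
  have hRa0 : 0 < Ra := by rw [hRa]; exact_mod_cast Nat.radical_pos a
  have hRb0 : 0 < Rb := by rw [hRb]; exact_mod_cast Nat.radical_pos b
  have hRc0 : 0 < Rc := by rw [hRc]; exact_mod_cast Nat.radical_pos (a - b)
  set P : ℝ := Ra * Rb with hP
  have hP0 : 0 < P := by positivity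
  -- Rc ≤ a
  have hRc_le : Rc ≤ (a : ℝ) := by
    rw [hRc]
    have h1 : radical (a - b) ≤ a - b := Nat.radical_le_self_iff.mpr (by omega)
    have h2 : a - b ≤ a := Nat.sub_le a b
    exact_mod_cast h1.trans h2
  -- from abc: a < C * (P * Rc)^(1+ε) = C * P^(1+ε) * Rc * Rc^ε ≤ C * P^(1+ε) * Rc * a^ε
  have h1 : (a : ℝ) < C * (P * Rc) ^ (1 + ε) := by
    have : ((rad b (a - b) a : ℕ) : ℝ) = P * Rc := by rw [hradeq, hP]; ring
    rw [this] at hA; exact hA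
  have h2 : (P * Rc) ^ (1 + ε) = P ^ (1 + ε) * (Rc * Rc ^ ε) := by
    rw [Real.mul_rpow hP0.le hRc0.le, Real.rpow_add hRc0, Real.rpow_one]
  have h3 : Rc ^ ε ≤ (a : ℝ) ^ ε := Real.rpow_le_rpow hRc0.le hRc_le hε.le
  have h4 : (a : ℝ) < C * P ^ (1 + ε) * (a : ℝ) ^ ε * Rc := by
    have hCP : 0 < C * P ^ (1 + ε) := by positivity
    calc (a : ℝ) < C * (P * Rc) ^ (1 + ε) := h1
      _ = C * P ^ (1 + ε) * Rc * Rc ^ ε := by rw [h2]; ring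
      _ ≤ C * P ^ (1 + ε) * Rc * (a : ℝ) ^ ε := by gcongr
      _ = C * P ^ (1 + ε) * (a : ℝ) ^ ε * Rc := by ring
  -- target
  have hlow := radical_div_le_bakerXi hb hba
  have haε : 0 < (a : ℝ) ^ ε := Real.rpow_pos_of_pos ha0 _
  have hPε : 0 < P ^ (1 + ε) := Real.rpow_pos_of_pos hP0 _
  have h5 : 1 / C * P ^ (-(1 + ε)) * (a : ℝ) ^ (-ε) = (a : ℝ) / (C * P ^ (1 + ε) * (a : ℝ) ^ ε) / (a : ℝ) := by
    rw [Real.rpow_neg hP0.le, Real.rpow_neg ha0.le]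
    field_simp
  have h6 : (a : ℝ) / (C * P ^ (1 + ε) * (a : ℝ) ^ ε) ≤ Rc := by
    rw [div_le_iff₀ (by positivity)]
    linarith [h4]
  calc 1 / C * P ^ (-(1 + ε)) * (a : ℝ) ^ (-ε)
        = (a : ℝ) / (C * P ^ (1 + ε) * (a : ℝ) ^ ε) / (a : ℝ) := h5
    _ ≤ Rc / (a : ℝ) := by gcongr
    _ ≤ bakerXi a b := hlow

/-- One-sided step of the converse: with the all-places bound at `δ`, an abc triple `w + u = z` with
`w ≤ u` satisfies `z^(1-δ) ≤ (2/K) · rad(wuz)^(1+δ)`. [folklore] -/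
theorem rpow_le_of_xiLowerBound {δ K : ℝ} (hδ0 : 0 < δ) (hK : 0 < K)
    (H : ∀ a b : ℕ, 0 < b → b < a → Nat.Coprime a b →
      K * (((radical a : ℕ) : ℝ) * ((radical b : ℕ) : ℝ)) ^ (-(1 + δ)) * (a : ℝ) ^ (-δ) ≤ bakerXi a b)
    {w u z : ℕ} (hw : 0 < w) (hwu : w ≤ u) (hz : w + u = z) (hcop : Nat.Coprime w u) :
    (z : ℝ) ^ (1 - δ) ≤ 2 / K * ((rad w u z : ℕ) : ℝ) ^ (1 + δ) := by
  have hu : 0 < u := by omega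
  have huz : u < z := by omega
  have hzu : Nat.Coprime z u := by
    rw [← hz, Nat.Coprime, Nat.gcd_comm, Nat.gcd_add_self_right]; exact hcop.symm
  have hH := H z u hu huz hzu
  have hsub : z - u = w := by omega
  have hup := bakerXi_le_radical_div hu huz
  rw [hsub] at hup
  have hz0 : (0 : ℝ) < z := by exact_mod_cast (show 0 < z by omega)
  have hu0 : (0 : ℝ) < u := by exact_mod_cast hu
  set Rz : ℝ := ((radical z : ℕ) : ℝ) with hRz
  set Ru : ℝ := ((radical u : ℕ) : ℝ) with hRu
  set Rw : ℝ := ((radical w : ℕ) : ℝ) with hRw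
  have hRz0 : 0 < Rz := by rw [hRz]; exact_mod_cast Nat.radical_pos z
  have hRu0 : 0 < Ru := by rw [hRu]; exact_mod_cast Nat.radical_pos u
  have hRw1 : 1 ≤ Rw := by rw [hRw]; exact_mod_cast Nat.radical_pos w
  have hRw0 : 0 < Rw := by linarith
  set P : ℝ := Rz * Ru with hP
  have hP0 : 0 < P := by positivity
  have hN : ((rad w u z : ℕ) : ℝ) = Rw * Ru * Rz := rad_eq_mul_of_isABCTriple ⟨hw, hu, hz, hcop⟩
  -- K * P^(-(1+δ)) * z^(-δ) ≤ Rw / u  ⟹  u ≤ (1/K) * P^(1+δ) * z^δ * Rw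
  have h1 : K * P ^ (-(1 + δ)) * (z : ℝ) ^ (-δ) ≤ Rw / (u : ℝ) := hH.trans hup
  have hPδ : 0 < P ^ (1 + δ) := Real.rpow_pos_of_pos hP0 _
  have hzδ : 0 < (z : ℝ) ^ δ := Real.rpow_pos_of_pos hz0 _
  have h2 : (u : ℝ) ≤ 1 / K * P ^ (1 + δ) * (z : ℝ) ^ δ * Rw := by
    rw [Real.rpow_neg hP0.le, Real.rpow_neg hz0.le] at h1
    rw [le_div_iff₀ hu0] at h1
    -- h1 : K * (P^(1+δ))⁻¹ * (z^δ)⁻¹ * u ≤ Rw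
    have : (u : ℝ) = (1 / K * P ^ (1 + δ) * (z : ℝ) ^ δ) * (K * (P ^ (1 + δ))⁻¹ * ((z : ℝ) ^ δ)⁻¹ * u) := by
      field_simp
    rw [this]
    exact mul_le_mul_of_nonneg_left h1 (by positivity)
  -- P^(1+δ) * Rw ≤ (Rw Ru Rz)^(1+δ)
  have h3 : P ^ (1 + δ) * Rw ≤ (Rw * Ru * Rz) ^ (1 + δ) := by
    have hRwδ : Rw ≤ Rw ^ (1 + δ) := by
      have := Real.rpow_le_rpow_of_exponent_le hRw1 (show (1 : ℝ) ≤ 1 + δ by linarith)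
      rwa [Real.rpow_one] at this
    calc P ^ (1 + δ) * Rw ≤ P ^ (1 + δ) * Rw ^ (1 + δ) := by gcongr
      _ = (P * Rw) ^ (1 + δ) := by rw [Real.mul_rpow hP0.le hRw0.le]
      _ = (Rw * Ru * Rz) ^ (1 + δ) := by rw [hP]; ring_nf
  -- z ≤ 2u
  have h4 : (z : ℝ) ≤ 2 * (u : ℝ) := by
    have : z ≤ 2 * u := by omega
    exact_mod_cast this
  have hNpos : 0 < (Rw * Ru * Rz) ^ (1 + δ) := Real.rpow_pos_of_pos (by positivity) _
  have h5 : (z : ℝ) ≤ 2 / K * (Rw * Ru * Rz) ^ (1 + δ) * (z : ℝ) ^ δ := by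
    calc (z : ℝ) ≤ 2 * (u : ℝ) := h4
      _ ≤ 2 * (1 / K * P ^ (1 + δ) * (z : ℝ) ^ δ * Rw) := by linarith [h2]
      _ = 2 / K * (P ^ (1 + δ) * Rw) * (z : ℝ) ^ δ := by ring
      _ ≤ 2 / K * (Rw * Ru * Rz) ^ (1 + δ) * (z : ℝ) ^ δ := by gcongr
  -- divide by z^δ
  have h6 : (z : ℝ) ^ (1 - δ) = (z : ℝ) * ((z : ℝ) ^ δ)⁻¹ := by
    rw [Real.rpow_sub hz0, Real.rpow_one, div_eq_mul_inv]
  rw [h6, hN]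
  calc (z : ℝ) * ((z : ℝ) ^ δ)⁻¹ ≤ (2 / K * (Rw * Ru * Rz) ^ (1 + δ) * (z : ℝ) ^ δ) * ((z : ℝ) ^ δ)⁻¹ :=
        mul_le_mul_of_nonneg_right h5 (by positivity)
    _ = 2 / K * (Rw * Ru * Rz) ^ (1 + δ) := by field_simp

/-- **The all-places bound for `Λ = log(a/b)` implies abc.** [folklore] -/
theorem abc_of_xiLowerBound (hX : XiLowerBound) : ABC := by
  rw [ABC_iff]
  intro ε hε
  -- δ = ε/(2+ε):  (1+δ)/(1-δ) = 1+ε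
  set δ : ℝ := ε / (2 + ε) with hδdef
  have hδ0 : 0 < δ := by positivity
  have hδ1 : δ < 1 := by rw [hδdef, div_lt_one (by positivity)]; linarith
  have h1δ : 0 < 1 - δ := by linarith
  have hexp : (1 + δ) * (1 / (1 - δ)) = 1 + ε := by
    rw [hδdef]; field_simp; ring
  obtain ⟨K, hK, H⟩ := hX δ hδ0
  set C : ℝ := (2 / K) ^ (1 / (1 - δ)) with hCdef
  have hC0 : 0 < C := by positivity
  refine ⟨C + 1, by positivity, ?_⟩
  intro x y z ht
  have hR := rad_cast_pos ht
  obtain ⟨hx, hy, hxyz, hcop⟩ := ht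
  have hz0 : (0 : ℝ) ≤ z := Nat.cast_nonneg _
  -- the one-sided bound, in either orientation
  have hmain : (z : ℝ) ^ (1 - δ) ≤ 2 / K * ((rad x y z : ℕ) : ℝ) ^ (1 + δ) := by
    rcases le_or_gt x y with hxy | hyx
    · exact rpow_le_of_xiLowerBound hδ0 hK H hx hxy hxyz hcop
    · have h := rpow_le_of_xiLowerBound hδ0 hK H hy hyx.le (by omega : y + x = z) hcop.symm
      have hsw : rad y x z = rad x y z := by rw [rad_def, rad_def, mul_comm y x]
      rwa [hsw] at h
  have hz1 := le_rpow_one_div_of_rpow_le h1δ hz0 hmain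
  have hrew : (2 / K * ((rad x y z : ℕ) : ℝ) ^ (1 + δ)) ^ (1 / (1 - δ))
      = C * ((rad x y z : ℕ) : ℝ) ^ (1 + ε) := by
    rw [Real.mul_rpow (by positivity) (Real.rpow_nonneg hR.le _), ← Real.rpow_mul hR.le, hexp]
  rw [hrew] at hz1
  have hpow : 0 < ((rad x y z : ℕ) : ℝ) ^ (1 + ε) := Real.rpow_pos_of_pos hR _
  calc (z : ℝ) ≤ C * ((rad x y z : ℕ) : ℝ) ^ (1 + ε) := hz1
    _ < (C + 1) * ((rad x y z : ℕ) : ℝ) ^ (1 + ε) := by nlinarith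

/-- **abc ⟺ the all-places lower bound for one linear form in two logarithms.** [folklore] -/
theorem abc_iff_xiLowerBound : ABC ↔ XiLowerBound :=
  ⟨xiLowerBound_of_abc, abc_of_xiLowerBound⟩

end Summit.ABC.ABC.Theorems

end
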